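import Summits.ABC.StewartYu.PadicG3SatLevels
import Summits.ABC.StewartYu.PadicG3SatHalfSeparation
import Summits.ABC.StewartYu.PadicG3LevelStepH
import HarnessLib

/-!
# Cell abc-stewartyu, WP-L.P(odd) (crux r3 `PadicCoreOddRat`, stmt-ABC-20503): THE KUMMER HALF-STEP ON THE SATURATED LEVEL INVARIANT
# (`(s, n) → (s+1, 0)`) — both boxes halve; the record clears only the SIGNED floor parts `∏ θⱼ^{⌊vᵢⱼ s/2⌋}`

`Summits/ABC/StewartYu/PadicG3SatLevelStepH.lean` — cell `abc-stewartyu` (HOME `run/shared/lean/pub/abc-stewartyu/`, design memo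
HOME/p2/memo-07-WPLP-odd-Nframe-design.md §2 row «half-step algebra», kill test K3; seat p2-g6).  One definition (`htermS`, the signed summand)
and theorems on `G3Setup`; no named fact, no parameters.

Twin of `PadicG3LevelStepH.LvInvI.halfStep` (p2-g4) for `LvInvSatI`: the extrapolation bound at `s₁/2` (`norm_g3F_le_of_zerosΦ`, UNMODIFIED), the
exponent-class data (`exists_expClass_pm`) and natural root exponents `rootExp L vᵢ s₁` on the θ-box `L` (verbatim), but the SEPARATION is
`classSums_eq_zero_of_norm_g3Φ_half_lt_scaled` with the common `p`-unit `Q = ∏ θⱼ^{Lⱼ|s₁|}` pulled out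
(`qEhG θ (rootExp L vᵢ s₁) = Q · ∏ θⱼ^{⌊vᵢⱼ s₁/2⌋}`), so the RECORD INTERFACE is: per odd `s₁` and order `τ`, integrality
`D·(Hasse·zγpow·∏ θⱼ^{⌊vᵢⱼ s₁/2⌋}) ∈ ℤ` (cleared VIRTUALLY by `SatData.exists_int_Dh_mul_prod_floor`), total size `≤ Mb`, and the landed
inequality `extrapolation bound < D/(4D²Mb(∏H θ)³)^{2^{n+1}}`.  Then the descent is the landed one (pivot class, PM sign = new sign class,
`descent_dirMoments_shift`), and the NEW STATE is `LvInvSatI F R′ B″ w (sgnOf w) pv lo′ ⌊L/2⌋ vlo′ ⌊Bv/2⌋ P m {x odd, |x| ≤ 2N₁−1} T′` with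
`lo′ = −⌊(v_{i₀} − lo)/2⌋`, `vlo′ = −⌊(ν(v_{i₀}) − vlo)/2⌋` (`ν(w) = (ν(vᵢ) − ν(v_{i₀}))/2` exactly).

References: Yu. V. Nesterenko, LNM 1819 (2003) §4.3, (4.50); K. Yu, Compositio 74 (1990) Lemma 2.5, (2.101)–(2.106); Acta Math. 211 (2013) Lemma 5.4.
-/

noncomputable section

open NormedSpace Finset Polynomial
open scoped Matrix
open Literature.NumberTheory.Transcendental
open Literature.NumberTheory.Transcendental.PadicCW77 (condExp)
open Literature.NumberTheory.Transcendental.CW77.Setup (Tau tauNorm)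
open scoped Nat

namespace Summit.ABC.StewartYu

namespace G3Setup

variable {p : ℕ} [Fact p.Prime] {S : G3Setup p} {ι : Type*}

/-! ### Signed floor algebra at a half point -/

/-- The generators are `p`-adic units: `‖θⱼ‖_p = 1`. [folklore] -/
theorem norm_ratCast_α (S : G3Setup p) (j : Fin S.n) : ‖(S.α j : ℚ_[p])‖ = 1 := by
  have h := S.norm_ω j
  unfold ω at h
  rwa [norm_mul, S.norm_η, mul_one] at h

/-- A monomial in the generators is a `p`-adic unit. [folklore] -/
theorem norm_ratCast_prod_zpow_α (S : G3Setup p) (e : Fin S.n → ℤ) : ‖((∏ j, S.α j ^ e j : ℚ) : ℚ_[p])‖ = 1 := by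
  push_cast
  rw [norm_prod]
  exact prod_eq_one fun j _ => by rw [norm_zpow, S.norm_ratCast_α, one_zpow]

/-- **The rational part of the natural root monomial is the box unit times the SIGNED floor part**:
`qEhG θ (rootExp L w s) = (∏ⱼ θⱼ^{Lⱼ|s|}) · ∏ⱼ θⱼ^{⌊wⱼ s/2⌋}` for `|wⱼ| ≤ Lⱼ`. [cite: Nesterenko2003, §4.3 (4.50); shape only] -/
theorem qEhG_rootExp_eq_unit_mul_floor (S : G3Setup p) {L : Fin S.n → ℕ} {w : Fin S.n → ℤ} (hw : ∀ j, |w j| ≤ (L j : ℤ)) (s : ℤ) :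
    HalfMono.qEhG S.α (S.rootExp L w s) = (∏ j, S.α j ^ ((L j : ℤ) * |s|)) * ∏ j, S.α j ^ (w j * s / 2) := by
  have h := S.qEhG_rootExp_of_shift (w' := 0) (κ := w) hw (by simp) s
  rw [h]
  have h0 : (∏ j, S.α j ^ ((0 : Fin S.n → ℤ) j * s)) = 1 := prod_eq_one fun j _ => by simp
  rw [h0, one_mul, ← prod_mul_distrib]
  exact prod_congr rfl fun j _ => by rw [← zpow_add₀ (S.α_ne j)]

/-- **On a parity class the signed floor parts share a common factor**: if `u = κ + 2•w` then
`∏ⱼ θⱼ^{⌊uⱼ s/2⌋} = (∏ⱼ θⱼ^{wⱼ s}) · ∏ⱼ θⱼ^{⌊κⱼ s/2⌋}`. [cite: Yu1990, (2.103); shape only] -/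
theorem prod_zpow_floor_of_class (S : G3Setup p) {u w κ : Fin S.n → ℤ} (huw : u = κ + (2 : ℤ) • w) (s : ℤ) :
    ∏ j, S.α j ^ (u j * s / 2) = (∏ j, S.α j ^ (w j * s)) * ∏ j, S.α j ^ (κ j * s / 2) := by
  rw [← prod_mul_distrib]
  refine prod_congr rfl fun j _ => ?_
  rw [← zpow_add₀ (S.α_ne j)]
  congr 1
  have hj : u j = κ j + 2 * w j := by rw [huw]; simp only [Pi.add_apply, Pi.smul_apply, smul_eq_mul]
  rw [hj]
  have : (κ j + 2 * w j) * s = κ j * s + 2 * (w j * s) := by ring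
  rw [this]
  omega

namespace LvInvSatI

variable {F : S.SatData} {R R' : ι → ℚ[X]} {B : Finset ι} {v : ι → Fin S.n → ℤ} {sgn pv : ι → ℤ} {lo : Fin S.n → ℤ} {L : Fin S.n → ℕ}
  {vlo : Fin S.n → ℤ} {Bv : Fin S.n → ℕ} {P : ℤ} {m N T : ℕ}

/-- The SIGNED summand of the PM class sums at `(s₁, τ)` without its sign and coefficient:
`Hasse_{t₀}Rᵢ(s₁/2) · zγpow(vᵢ,t′) · ∏ⱼ θⱼ^{⌊vᵢⱼ s₁/2⌋}`. [folklore] -/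
def htermS (S : G3Setup p) (R : ι → ℚ[X]) (v : ι → Fin S.n → ℤ) (s₁ : ℤ) (τ : Tau S.n) (i : ι) : ℚ :=
  ((hasseDeriv τ.1 (R i)).eval ((s₁ : ℚ) / 2) * S.zγpow v i τ.2) * ∏ j, S.α j ^ (v i j * s₁ / 2)

/-- `hterm = Q · htermS` with the box unit `Q = ∏ θⱼ^{Lⱼ|s₁|}`. [folklore] -/
theorem hterm_eq_unit_mul_htermS {i : ι} (hv : ∀ j, |v i j| ≤ (L j : ℤ)) (s₁ : ℤ) (τ : Tau S.n) :
    LvInvI.hterm S R v L s₁ τ i = (∏ j, S.α j ^ ((L j : ℤ) * |s₁|)) * htermS S R v s₁ τ i := by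
  unfold LvInvI.hterm htermS
  rw [S.qEhG_rootExp_eq_unit_mul_floor hv s₁]
  ring

/-- **The virtual exponents of the halved family**: on the parity class, `ν(wᵢ) = (ν(vᵢ) − ν(v_{i₀}))/2` exactly. [folklore] -/
theorem vecMul_halfDiff (F : S.SatData) (v : ι → Fin S.n → ℤ) (i₀ : ι) {i : ι} (hpar : ∀ j, 2 ∣ v i j - v i₀ j) (j : Fin S.n) :
    (v i ᵥ* F.U) j = (v i₀ ᵥ* F.U) j + 2 * (S.halfDiff v i₀ i ᵥ* F.U) j := by
  have e := S.eq_add_two_smul_halfDiff v i₀ hpar (i := i)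
  have : v i ᵥ* F.U = v i₀ ᵥ* F.U + (2 : ℤ) • (S.halfDiff v i₀ i ᵥ* F.U) := by
    conv_lhs => rw [e]
    rw [Matrix.add_vecMul, Matrix.smul_vecMul]
  have h := congrFun this j
  simp only [Pi.add_apply, Pi.smul_apply, smul_eq_mul] at h
  exact h

/-- **THE HALF-STEP ON THE SATURATED LEVEL INVARIANT.** [cite: Nesterenko2003, §4.3] [cite: Yu1990, Lemma 2.5] -/
theorem halfStep [DecidableEq ι] (h : S.LvInvSatI F R B v sgn pv lo L vlo Bv P m {x : ℤ | |x| ≤ (N : ℤ)} T)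
    (hΛ : ‖S.Λ / (S.b S.j₀ : ℚ_[p])‖ ≤ (p : ℝ)⁻¹) (hΛm : ‖S.Λ / (S.b S.j₀ : ℚ_[p])‖ ≤ (p : ℝ)⁻¹ ^ (m + 1))
    {ζ : ℚ_[p]} (hζ : IsPrimitiveRoot ζ (p - 1)) (hζM : ζ ^ ((p - 1) / 2) = -1) (hζ1 : ‖ζ‖ = 1) (r : Fin S.n → ℕ)
    (hη : ∀ j, S.η j = ζ ^ r j)
    (hind : ∀ T₁ : Finset (Fin S.n), T₁.Nonempty → ¬ IsSquare (∏ j ∈ T₁, S.α j) ∧ ¬ IsSquare (-∏ j ∈ T₁, S.α j))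
    {N₁ T' t : ℕ} (ht : 1 ≤ t) (hT : T' + t ≤ T)
    {Bw : ℝ} (hBw0 : 0 ≤ Bw) (hBw : ∀ i ∈ B, ∀ t₀ k, ‖(hw (p := p) R i t₀).coeff k‖ * ((p : ℝ) ^ m * Real.sqrt p) ^ k ≤ Bw)
    (c : ℕ → ℚ) (hc : ∀ t₀, c t₀ ≠ 0)
    (hRR' : ∀ i ∈ B, ∀ (t₀ : ℕ) (s₁ : ℤ), (hasseDeriv t₀ (R i)).eval ((s₁ : ℚ) / 2) = c t₀ * (hasseDeriv t₀ (R' i)).eval (s₁ : ℚ))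
    (D : ℤ → Tau S.n → ℕ) (hD : ∀ s₁ τ, 1 ≤ D s₁ τ) (Mb : ℤ → Tau S.n → ℝ) (hMb : ∀ s₁ τ, 1 ≤ Mb s₁ τ)
    (hint : ∀ (s₁ : ℤ) (τ : Tau S.n), ∀ i ∈ B, ∃ z : ℤ, (D s₁ τ : ℚ) * htermS S R v s₁ τ i = z)
    (hsize : ∀ (s₁ : ℤ) (τ : Tau S.n), ∑ i ∈ B, |((pv i : ℚ) * htermS S R v s₁ τ i : ℝ)| ≤ Mb s₁ τ)
    (hineq : ∀ s₁ : ℤ, Odd s₁ → |s₁| ≤ (2 * N₁ - 1 : ℤ) → ∀ τ : Tau S.n, tauNorm τ + t ≤ T →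
      max (Bw * ‖S.Λ / (S.b S.j₀ : ℚ_[p])‖ * (p : ℝ) ^ ((t - 1) / 2) * (p : ℝ) ^ condExp p (2 * N + 1) t)
        (Bw / ((p : ℝ) ^ m * Real.sqrt p) ^ ((2 * N + 1) * t)) <
      (D s₁ τ : ℝ) / (4 * (D s₁ τ : ℝ) ^ 2 * Mb s₁ τ * CW77.heightProd S.α ^ 3) ^ (2 ^ (S.n + 1))) :
    ∃ i₀ ∈ B, pv i₀ ≠ 0 ∧
      S.LvInvSatI F R' (S.pivotClass v sgn B i₀) (S.halfDiff v i₀) (S.sgnOf (S.halfDiff v i₀)) pv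
        (fun j => -((v i₀ j - lo j) / 2)) (fun j => L j / 2)
        (fun j => -(((v i₀ ᵥ* F.U) j - vlo j) / 2)) (fun j => Bv j / 2) P m {x : ℤ | Odd x ∧ |x| ≤ (2 * N₁ - 1 : ℤ)} T' := by
  classical
  have hI := h.toI
  obtain ⟨i₀, hi₀B, hi₀⟩ := hI.nonzero
  refine ⟨i₀, hi₀B, hi₀, ?_⟩
  have hsub := S.pivotClass_subset v sgn B i₀
  have hpar : ∀ i ∈ S.pivotClass v sgn B i₀, ∀ j, 2 ∣ v i j - v i₀ j := fun i hi => (S.mem_pivotClass.mp hi).2.1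
  have hsg : ∀ i ∈ S.pivotClass v sgn B i₀, sgn i = sgn i₀ := fun i hi => (S.mem_pivotClass.mp hi).2.2
  have hsgn0 : (sgn i₀ : ℚ_[p]) ≠ 0 := by rcases hI.sgn_pm i₀ with h1 | h1 <;> rw [h1] <;> norm_num
  -- the new sign classes
  have hsq : ∀ i ∈ S.pivotClass v sgn B i₀, S.cls (S.halfDiff v i₀ i) ^ 2 = 1 := fun i hi =>
    S.cls_halfDiff_sq v i₀ (hpar i hi) hsgn0 (by rw [hI.cls i (hsub hi), hsg i hi]) (hI.cls i₀ hi₀B)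
  refine ⟨⟨⟨i₀, S.self_mem_pivotClass hi₀B, hi₀⟩, fun i hi => hI.bound i (hsub hi), ?_, ?_, fun i => S.sgnOf_pm _ i,
    fun i hi => S.cls_eq_sgnOf _ i (hsq i hi), ?_, ?_, ?_⟩, ?_, ?_⟩
  · -- the new θ-interval contains `0`
    intro j
    have h1 := hI.box i₀ hi₀B j
    have h2 := hI.lo_le j
    constructor <;> omega
  · -- the new θ-box
    intro i hi j
    have h1 := hI.box i (hsub hi) j
    have h2 := hI.box i₀ hi₀B j
    obtain ⟨cc, hcc⟩ := hpar i hi j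
    have hw : S.halfDiff v i₀ i j = cc := by simp only [halfDiff]; rw [hcc, Int.mul_ediv_cancel_left _ two_ne_zero]
    rw [hw]
    constructor <;> omega
  · -- depth
    intro i hi
    exact S.norm_E_halfDiff_le v i₀ (hpar i hi) (hI.slab i (hsub hi) i₀ hi₀B) hΛm
  · -- slab
    intro i hi i' hi'
    exact S.norm_Lsum_halfDiff_sub_le v i₀ (hpar i hi) (hpar i' hi') (hI.slab i (hsub hi) i' (hsub hi'))
  · -- THE VANISHING at the odd points
    intro s₁ hs₁ τ hτ
    obtain ⟨hs₁odd, hs₁le⟩ := hs₁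
    -- data depending on `s₁` only: exponent class and roots
    obtain ⟨c₀, a, k, q, hclass, hq, hk⟩ := S.exists_expClass_pm hζ hζM r hη v B sgn hI.sgn_pm hI.cls hI.abs_le s₁
    obtain ⟨ξ, ιC, ŝ, hξM, hι2, hξ, hσ, hŝ, hŝ1⟩ := S.exists_halfStep_rootData hζM hζ1 r hη
    have he : ∀ i ∈ B, ∏ j, S.sq j ^ (v i j * s₁) = (∏ j, S.ω j ^ (-((L j : ℤ) * |s₁|))) * ∏ j, S.sq j ^ (S.rootExp L (v i) s₁ j) :=
      fun i hi => S.prod_sq_zpow_eq_unit_mul (hI.abs_le i hi) s₁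
    have hzeroΦ : ∀ x : ℤ, |x| ≤ (N : ℤ) → ∀ τ'' : Tau S.n, tauNorm τ'' < T → S.g3Φ R v B pv τ'' (x : ℚ_[p]) = 0 := by
      intro x hx τ'' hτ''
      rw [S.g3Φ_intCast_pm R v B sgn hI.sgn_pm hI.cls, hI.vanish x hx τ'' hτ'', Rat.cast_zero]
    have hz : ‖(2 : ℚ_[p])⁻¹ * (s₁ : ℚ_[p])‖ ≤ 1 := by
      rw [norm_mul, norm_inv, PadicExp.norm_two_eq_one S.hp3, inv_one, one_mul]; exact Padic.norm_int_le_one _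
    have hδ : ∀ i, ((if sgn i = 1 then 0 else 1 : ℤ)) = 0 ∨ ((if sgn i = 1 then 0 else 1 : ℤ)) = 1 := fun i => by
      by_cases h1 : sgn i = 1 <;> simp [h1]
    -- the box unit and the signed floor parts
    set Q : ℚ := ∏ j, S.α j ^ ((L j : ℤ) * |s₁|) with hQdef
    have hQ : ‖(Q : ℚ_[p])‖ = 1 := S.norm_ratCast_prod_zpow_α _
    have hg : ∀ i ∈ B, HalfMono.qEhG S.α (S.rootExp L (v i) s₁) = Q * ∏ j, S.α j ^ (v i j * s₁ / 2) :=
      fun i hi => S.qEhG_rootExp_eq_unit_mul_floor (hI.abs_le i hi) s₁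
    -- the pivot class is the PM fibre of the pivot
    have hset : S.pivotClass v sgn B i₀ =
        (B.filter (fun i => (Even (k i) ↔ Even (k i₀)))).filter (fun i => HalfMono.SsetG (S.rootExp L (v i) s₁) =
          HalfMono.SsetG (S.rootExp L (v i₀) s₁)) := by
      ext i
      rw [S.mem_pivotClass, mem_filter, mem_filter]
      constructor
      · rintro ⟨hiB, hpr, hsgi⟩
        refine ⟨⟨hiB, ?_⟩, (S.SsetG_eq_iff (hI.abs_le i hiB) (hI.abs_le i₀ hi₀B) hs₁odd).mpr hpr⟩
        refine (even_k_iff (δ := fun i => if sgn i = 1 then (0 : ℤ) else 1) hs₁odd (hk i hiB) (hk i₀ hi₀B) (hδ i) (hδ i₀)).mpr ?_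
        rw [hsgi]
      · rintro ⟨⟨hiB, hev⟩, hss⟩
        refine ⟨hiB, (S.SsetG_eq_iff (hI.abs_le i hiB) (hI.abs_le i₀ hi₀B) hs₁odd).mp hss, ?_⟩
        have hd := (even_k_iff (δ := fun i => if sgn i = 1 then (0 : ℤ) else 1) hs₁odd (hk i hiB) (hk i₀ hi₀B) (hδ i) (hδ i₀)).mp hev
        rcases hI.sgn_pm i with h1 | h1 <;> rcases hI.sgn_pm i₀ with h2 | h2 <;> simp [h1, h2] at hd ⊢
    -- (1)–(4): the SCALED fibre identity at every order `τ'` in range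
    have hfibAll : ∀ τ' : Tau S.n, tauNorm τ' + t ≤ T →
        ∑ i ∈ S.pivotClass v sgn B i₀, (((-1) ^ (k i / 2) * pv i : ℤ) : ℚ) * htermS S R v s₁ τ' i = 0 := by
      intro τ' hτ'
      have hbound := (S.norm_g3F_le_of_zerosΦ R v m B hI.depth pv ht hBw0 hBw hΛ hzeroΦ hz τ' hτ').2
      have hlt := lt_of_le_of_lt hbound (hineq s₁ hs₁odd hs₁le τ' hτ')
      have hsep := S.classSums_eq_zero_of_norm_g3Φ_half_lt_scaled R v B pv τ' s₁ _ (S.norm_unit_eq_one L s₁)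
        (fun i => S.rootExp L (v i) s₁) he ŝ ξ ιC r k hσ hξM hι2 hξ hclass hŝ hŝ1 hind Q hQ
        (fun i => ∏ j, S.α j ^ (v i j * s₁ / 2)) hg (hD s₁ τ') (hMb s₁ τ') ?_ ?_ ?_ hlt
      rotate_left
      · intro T₁
        have : ∀ i ∈ (B.filter (fun i => Even (k i))).filter (fun i => HalfMono.SsetG (S.rootExp L (v i) s₁) = T₁),
            ∃ z : ℤ, (D s₁ τ' : ℚ) * ((((-1) ^ (k i / 2) * pv i : ℤ) : ℚ) * htermS S R v s₁ τ' i) = z := by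
          intro i hi
          have hiB : i ∈ B := (mem_filter.mp (mem_filter.mp hi).1).1
          obtain ⟨z, hz⟩ := hint s₁ τ' i hiB
          exact ⟨(-1) ^ (k i / 2) * pv i * z, by push_cast; rw [← hz]; ring⟩
        choose! z hz using this
        refine ⟨∑ i ∈ (B.filter (fun i => Even (k i))).filter (fun i => HalfMono.SsetG (S.rootExp L (v i) s₁) = T₁), z i, ?_⟩
        rw [mul_sum]; push_cast
        exact sum_congr rfl fun i hi => by rw [← hz i hi]; unfold htermS; push_cast; ring
      · intro T₁
        have : ∀ i ∈ (B.filter (fun i => ¬ Even (k i))).filter (fun i => HalfMono.SsetG (S.rootExp L (v i) s₁) = T₁),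
            ∃ z : ℤ, (D s₁ τ' : ℚ) * ((((-1) ^ (k i / 2) * pv i : ℤ) : ℚ) * htermS S R v s₁ τ' i) = z := by
          intro i hi
          have hiB : i ∈ B := (mem_filter.mp (mem_filter.mp hi).1).1
          obtain ⟨z, hz⟩ := hint s₁ τ' i hiB
          exact ⟨(-1) ^ (k i / 2) * pv i * z, by push_cast; rw [← hz]; ring⟩
        choose! z hz using this
        refine ⟨∑ i ∈ (B.filter (fun i => ¬ Even (k i))).filter (fun i => HalfMono.SsetG (S.rootExp L (v i) s₁) = T₁), z i, ?_⟩
        rw [mul_sum]; push_cast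
        exact sum_congr rfl fun i hi => by rw [← hz i hi]; unfold htermS; push_cast; ring
      · have hs := LvInvI.sum_abs_fibres_le (S := S) B k (fun i => S.rootExp L (v i) s₁)
          (fun i => (((-1) ^ (k i / 2) * pv i : ℤ) : ℚ) * htermS S R v s₁ τ' i)
        refine le_trans (le_of_eq ?_) (hs.trans (le_trans (le_of_eq ?_) (hsize s₁ τ')))
        · unfold htermS; rfl
        · refine sum_congr rfl fun i _ => ?_
          push_cast
          rw [abs_mul, abs_mul, abs_mul, abs_pow, abs_neg, abs_one, one_pow, one_mul, ← abs_mul]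
      -- the fibre of the pivot
      obtain ⟨hC₀, hC₁⟩ := hsep
      rw [hset]
      rcases Nat.even_or_odd (k i₀) with hev₀ | hodd₀
      · have hfilt : B.filter (fun i => (Even (k i) ↔ Even (k i₀))) = B.filter (fun i => Even (k i)) :=
          filter_congr fun i _ => by simp [hev₀]
        rw [hfilt]
        have := congrFun hC₀ (HalfMono.SsetG (S.rootExp L (v i₀) s₁))
        simpa [htermS] using this
      · have hfilt : B.filter (fun i => (Even (k i) ↔ Even (k i₀))) = B.filter (fun i => ¬ Even (k i)) :=
          filter_congr fun i _ => by simp [Nat.not_even_iff_odd.mpr hodd₀]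
        rw [hfilt]
        have := congrFun hC₁ (HalfMono.SsetG (S.rootExp L (v i₀) s₁))
        simpa [htermS] using this
    -- (5) the fibre identity in terms of the new family
    have hK0 : (∏ j, S.α j ^ (v i₀ j * s₁ / 2) : ℚ) ≠ 0 :=
      prod_ne_zero_iff.mpr fun j _ => zpow_ne_zero _ (S.α_ne j)
    have hsign : ∀ i ∈ S.pivotClass v sgn B i₀,
        ((-1 : ℚ)) ^ (k i / 2) = (-1 : ℚ) ^ (k i₀ / 2) * (S.sgnOf (S.halfDiff v i₀) i : ℚ) := by
      intro i hi
      have hiB := hsub hi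
      have hδi : (if sgn i = 1 then (0 : ℤ) else 1) = (if sgn i₀ = 1 then (0 : ℤ) else 1) := by rw [hsg i hi]
      have hki := hk i hiB
      rw [hδi] at hki
      have hqi := hq i hiB
      rw [hδi] at hqi
      have h1 := negOnePow_half_k (p := p) hs₁odd hki (hk i₀ hi₀B)
      have h2 := S.cls_halfDiff_eq hζ hζM r hη (hpar i hi) hqi (hq i₀ hi₀B)
      have h3 := S.cls_eq_sgnOf (S.halfDiff v i₀) i (hsq i hi)
      rw [← h2, h3] at h1
      have h1' : (((-1 : ℚ) ^ (k i / 2) : ℚ) : ℚ_[p]) = ((((-1 : ℚ) ^ (k i₀ / 2) * (S.sgnOf (S.halfDiff v i₀) i : ℚ)) : ℚ) : ℚ_[p]) := by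
        push_cast; exact h1
      exact_mod_cast (Rat.cast_injective (α := ℚ_[p])) h1'
    -- the `t`-independent weights of the new family at `(s₁, τ.1)`
    set W : ι → ℚ := fun i => (S.sgnOf (S.halfDiff v i₀) i : ℚ) * pv i * (hasseDeriv τ.1 (R' i)).eval (s₁ : ℚ) *
      ∏ j, S.α j ^ (S.halfDiff v i₀ i j * s₁) with hW
    have hterm_eq : ∀ i ∈ S.pivotClass v sgn B i₀, ∀ t' : Fin S.n → ℕ,
        (((-1) ^ (k i / 2) * pv i : ℤ) : ℚ) * htermS S R v s₁ (τ.1, t') i =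
        ((-1 : ℚ) ^ (k i₀ / 2) * c τ.1 * ∏ j, S.α j ^ (v i₀ j * s₁ / 2)) *
          (W i * ∏ k', S.zγ (v i) k' ^ t' k') := by
      intro i hi t'
      have hiB := hsub hi
      unfold htermS
      rw [hRR' i hiB τ.1 s₁, S.prod_zpow_floor_of_class (S.eq_add_two_smul_halfDiff v i₀ (hpar i hi)) s₁]
      push_cast
      rw [hsign i hi]
      simp only [hW, zγpow]
      ring
    have hold : ∀ t' : Fin S.n → ℕ, ∑ k', t' k' ≤ T' - 1 - τ.1 →
        ∑ i ∈ S.pivotClass v sgn B i₀, W i * ∏ k', S.zγ (v i) k' ^ t' k' = 0 := by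
      intro t' ht'
      have hτ' : tauNorm ((τ.1, t') : Tau S.n) + t ≤ T := by
        unfold tauNorm at hτ ⊢; simp only at hτ ⊢; omega
      have h0 := hfibAll (τ.1, t') hτ'
      rw [sum_congr rfl fun i hi => hterm_eq i hi t', ← mul_sum] at h0
      rcases mul_eq_zero.mp h0 with h1 | h1
      · exfalso
        refine (mul_ne_zero (mul_ne_zero (pow_ne_zero _ (by norm_num)) (hc τ.1)) hK0) h1
      · exact h1
    -- (6) triangular descent to the halved exponents
    have hnew := S.descent_dirMoments_shift v (S.halfDiff v i₀) (S.pivotClass v sgn B i₀) (fun k' => S.zγ (v i₀) k') two_ne_zero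
      (fun i hi k' => S.zγ_halfDiff v i₀ (hpar i hi) k') W (T' - 1 - τ.1) hold
    have hτ2 : ∑ k', τ.2 k' ≤ T' - 1 - τ.1 := by unfold tauNorm at hτ; omega
    have hfin := hnew τ.2 hτ2
    -- (7) this is the new vanishing
    unfold g3φ
    rw [← hfin]
    refine sum_congr rfl fun i _ => ?_
    have hodd1 : s₁.natAbs % 2 = 1 := Nat.odd_iff.mp (Int.natAbs_odd.mpr hs₁odd)
    simp only [hW, pvx, hodd1, pow_one, zγpow]
    push_cast
    ring
  · -- the new virtual interval contains `0`
    intro j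
    have h1 := h.vbox i₀ hi₀B j
    have h2 := h.vlo_le j
    constructor <;> omega
  · -- the new virtual box
    intro i hi j
    have h1 := h.vbox i (hsub hi) j
    have h2 := h.vbox i₀ hi₀B j
    have h3 := vecMul_halfDiff F v i₀ (hpar i hi) j
    generalize (S.halfDiff v i₀ i ᵥ* F.U) j = cc at h3 ⊢
    constructor <;> omega

end LvInvSatI

end G3Setup

end Summit.ABC.StewartYu

end
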